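import Mathlib
import HarnessLib
import Summits.HubbardSuperconductivity.HubbardSuperconductivity.Theorems.KLProgrammeKLRegimeSplitBundleV16
import Summits.HubbardSuperconductivity.HubbardSuperconductivity.Theorems.KLProgrammeKLRegimeCountertermJacksonFrame
import Summits.HubbardSuperconductivity.HubbardSuperconductivity.Theorems.KLProgrammeKLRegimeTwoLegCurvatureDefs
import Summits.HubbardSuperconductivity.HubbardSuperconductivity.Theorems.KLProgrammeKLRegimeSplitCounterMap

/-!
# Route `KLProgramme`, crux K3 `KLRegimeTwoPointLimit` (stmt-HubbardSuperconductivity-19937): the GEN-7-FLOW bundle `klPredsV17F`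
# — scheme F = FLOWING DISPERSION (Benfatto–Giuliani–Mastropietro 2006 (2.23) / Thm 3.1) hosted in the existing `Preds`/`HistP`/`EngineP4`…
# machinery with a DUMMY frame argument; text of record of plan g16's K3-FLOW RULING F (KL STATUS 2026-08-27 l.2548, S1), = the draft
# `HOME/p2-g10/flow-kit/KLProgrammeKLRegimeSplitSlotsV17F.draft.lean` 9bc93be599b741ca ⊕ (R27)/(R27′) reconciliation (v3 f6f3e1a6b4eef5a5), §8 (children
# texts + glue) left to k3c3-p2's S2 file `…KLRegimeChildrenV17F`

Cell gate-hubbard-kl, seat p2 g10 (bundle typist).  ONE file (D-0064), sections: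

* §0 the flow frame (flow-kit Defs v2): `klFlowFrameWith`, the Jackson
  piece `klFlowPieceJackson` ((F-a), k3c3-p2), the degree schedule `klFlowDeg`, **`klFlowFrameU L M β U μ n`** =: `K_n`
  (volume-dependent, fork PF-1 (α)), `klFlowPiece … n := klFlowPieceJackson … n (K_n)` (so `K_{n+1} = K_n ⊖ klFlowPiece n`), `klFlowAction`.
* §1 the ONE frame-independent reading ball (β′): every `∀ k ∈ klBall L μ K` of the V16 texts becomes `∀ k ∈ klBall L μ 0` (bare-frame ball).
* §2 the engine slot `EngineBoundsAtV17F`: V10S's eight conjuncts; the ONE-SHOT objects (`klSelfEnergy`, `klAnisoLegKernelNorm`, `klPairAmplitude … n`,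
  `klQuarticValue … n`, `klAnisoLegKernel`, `klIsoKernelAt`) are read at `K := K_n` verbatim (F-hybrid: `klEffectiveAction … K_n klE0 n`, no Grassmann
  recursion); the CROSS-SCALE clauses — (E2-v10)'s right inverse of `klPairArray … (n−1)`, (E2″)/(E2′) value increments — compare `(K_n, n)` with
  `(K_{n−1}, n−1)` (α′), and their majorants carry ONE NAMED extra term `frameShiftBar P Q U n` (the covariance response to the frame shift
  `K_{n−1} → K_n` at the scales `< n`; supplier: the p2 door chain p513900/p515302/p519430/p520898, linear in `frameDist K_n K_{n−1}`); the slice count is the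
  FLOWING count `legSliceCountT L β μ K_n n` (γ′, option 1), and the frame-RATE fact a flowing count lemma needs is DERIVED from the renormalisation
  history (§4, `FlowPieceJetsAt` at every `j < n` ⇒ `|K_n(p) − K_j(p)| ≤ Σ_{j ≤ m < n} Gfr 0·|U|·16^{−m}`), not a slot clause.
* §3 the two-leg slot `TwoLegStepV17F`: the CUMULATIVE-READING jets (pen (R25)(3), (R27′)(iii): the F two-leg text of record) —
  `TwoLegReadJetsF`: `θ ↦ ν_n(K_n)(θ) = klLocalPart … K_n n θ` is `C⁴` with `|∂_θ^k ·| ≤ curveJetBar G.S Q.S' U k n` (`TwoLegCurveJetBound` currency,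
  p517656) — ∧ `TwoLegSlopes … K_n n` ∧ the (E3f) two-volume rate at the flow frames OF EACH VOLUME (PF-1 (α): `K_n^{(L,M)}` vs `K_n^{(L′,M′)}`, T1d-T
  thresholds kept).  NO (E3c) frame-Lipschitz clause: under F there is no comparison class and no fixed point (the frame response is INTERNAL to the
  engine step, via `frameShiftBar`).  NO multi-slot sizes (`TwoLegSizesMSTQ`): the Jackson piece has certified degree `klFlowDeg n` by construction.
* §4 the renormalisation slot `RenormFlowAtV17F … R n` (what child 2F's FORWARD induction proves at stage `n` from the engine/two-leg output at `n`
  and the geometry step F6): `RenormalisedAtF … K_n R n` (the frame cancels the readings below `n`, so the scale-`n` reading is within tolerance) ∧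
  `FlowPieceJetsAt R U n` (the ACTUAL piece `klFlowPiece n` has the `Gfr`-jets of an admissible frame piece: Jackson ∘ tube extension of the jets of
  §3) ∧ `FlowGeometryAt μ n` (Lemma-2.1 geometry of `ε − μ − K_{n+1}`, the `GeomConstants` clause of `FrameOK`).  Consequence (bookkeeping, §6):
  the history below `n` yields `FrameOK R U (n−1) μ K_n`-shaped facts — exactly the CT engine's frame input, now at the flow frame.
* §5 `klPredsV17F : Preds` with the DUMMY frame argument (`frameOK := fun R U N μ K => K = 0 ∧ FrameOK R U N μ K`, (T-a) of (R27′)(i); every other slot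
  ignores `K` and reads `K_n`), and the
  `rfl`/`Iff.rfl` bookkeeping: `HistP klPredsV17F … K n` = the slot facts at `(K_j, j)`, `j < n`, whatever `K` is.
* §6 bookkeeping PROVED: `eval_klFlowFrameU` (`K_n = −Σ_{m<n} pieces`), `frameOK_klFlowFrameU_succ` ((I-F jets) ∀ m ≤ N + (I-F geometry) at N ⇒
  `FrameOK R U N μ K_{N+1}` — the CT engine's frame input at the flow frame), `abs_evalM_klFlowFrameU_sub_le` (the frame RATE from (I-F jets)).
* §7 design rows (comments only): (F-c) the angular MEAN of the reading is absorbed by the frame (as in CT), not by `μ`; (γ′) option 2 rejected (no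
  uniform margin at `Λ_n ≪ U²`); (E1-W) `KernelNormsWt` replaces `KernelNormsV4` by the same token swap as in C; the children texts + glue
  (`KLRegimeInductionP4 klPredsV17F FinalTwoLegVolLimitEx` VERBATIM, child 4-F at birth by `twoPointAssemblyP3_ex`; kernel-checked in the draft's §8,
  v2 7310b66ac4b8de81) are k3c3-p2's S2 file `…Theorems/KLProgrammeKLRegimeChildrenV17F.lean`.

NUMERALS: `klFlowDeg n := 2^7·4^n` (degree schedule, CONFIRMED by k3c3-p2 KL l.2556: `2·deg ≤ 2^8·4^{n_β} < klEngL₃ β U/2` and the Jackson error decays like the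
scale-`(n+1)` tolerance), `frameShiftBar P Q U n := Q.CR·(P.Klam·U)²·4^{−n}` (v3 shape, (R27′)(ii):
decaying, `U²`, `Q.CR`-keyed; `sum_frameShiftBar_le(_cube)`: `Σ_n ≤ (4/3)·Q.CR·(Klam U)² ≤ (4/3)·Q.CR·Klam³·U²`, inside child 1's `klLegKappa` slack).  Definitions + `rfl` bookkeeping only; nothing about the
model is asserted; no child of the re-split is proved here; nothing asserts superconductivity.
-/

noncomputable section

namespace Summit.HubbardSuperconductivity.HubbardSuperconductivity.Theorems.KLRegimeSplit

set_option linter.dupNamespace false -- summit = problem name (single-conjunct summit), D-0017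

open Real Finset Literature.MathematicalPhysics.QuantumLattice Literature.Probability.LatticeModels
open Literature.MathematicalPhysics.QuantumLattice.FermiRG
open Summit.HubbardSuperconductivity.HubbardSuperconductivity.Theorems.KLProgrammeLegKernels
open Summit.HubbardSuperconductivity.HubbardSuperconductivity.Theorems.DispersionFlow

/-! ## §0 The flow frame (flow-kit Defs v2, inlined) -/

/-- Flow of frames driven by a piece extractor: `K₀ = 0`, `K_{n+1} = K_n ⊖ piece n K_n`. -/
def klFlowFrameWith (piece : ℕ → TrigPolyC4v → TrigPolyC4v) : ℕ → TrigPolyC4v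
  | 0 => 0
  | n + 1 => fsub (klFlowFrameWith piece n) (piece n (klFlowFrameWith piece n))

/-- `K₀ = 0`. -/
@[simp] theorem klFlowFrameWith_zero (piece : ℕ → TrigPolyC4v → TrigPolyC4v) : klFlowFrameWith piece 0 = 0 := rfl

/-- `K_{n+1} = K_n ⊖ piece n K_n`. -/
theorem klFlowFrameWith_succ (piece : ℕ → TrigPolyC4v → TrigPolyC4v) (n : ℕ) :
    klFlowFrameWith piece (n + 1) = fsub (klFlowFrameWith piece n) (piece n (klFlowFrameWith piece n)) := rfl

/-- **The degree schedule** of the Jackson pieces: `klFlowDeg n := 2^7 · 4^n` (k3c3-p2 (F-a), confirmed KL l.2556: the Jackson error of `ν_n` is below the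
scale-`(n+1)` tolerance under an engine-side `U₀`, and `2·klFlowDeg n_β < klEngL₃ β U / 2` keeps lattice exactness). -/
def klFlowDeg (n : ℕ) : ℕ := 2 ^ 7 * 4 ^ n

section Model

variable (L M : ℕ) [NeZero L] [NeZero M]

/-- The JACKSON piece extractor ((F-a), k3c3-p2): the Jackson mean of degree `klFlowDeg n` of the continuum tube extension `klFrameExtFn μ (ν_n(K))` of
the scale-`n` local part of the frame-`K` action read on `K`'s own curve. -/
def klFlowPieceJackson (β U μ : ℝ) (n : ℕ) (K : TrigPolyC4v) : TrigPolyC4v :=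
  jacksonFrame (klFlowDeg n) (klFrameExtFn μ (fun θ => klLocalPart L M β U μ K n θ))

/-- **The flow frame `K_n`** of the model at `(β, U, μ)` in the volume `(L, M)` (fork PF-1 (α): volume-dependent). -/
def klFlowFrameU (β U μ : ℝ) : ℕ → TrigPolyC4v :=
  klFlowFrameWith (klFlowPieceJackson L M β U μ)

/-- **The scale-`n` flow piece** `klFlowPiece n := klFlowPieceJackson n (K_n)`, so that `K_{n+1} = K_n ⊖ klFlowPiece n`. -/
def klFlowPiece (β U μ : ℝ) (n : ℕ) : TrigPolyC4v :=
  klFlowPieceJackson L M β U μ n (klFlowFrameU L M β U μ n)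

/-- **The flow action at scale `n`** = the ONE-SHOT countertermed effective action at the flow frame (F-hybrid; no Grassmann recursion). -/
def klFlowAction (β U μ : ℝ) (n : ℕ) : HubbardGrassmann L M :=
  klEffectiveAction L M β U μ (klFlowFrameU L M β U μ n) klE0 n

/-- `K₀ = 0`. -/
theorem klFlowFrameU_zero (β U μ : ℝ) : klFlowFrameU L M β U μ 0 = 0 := rfl

/-- `K_{n+1} = K_n ⊖ klFlowPiece n`. -/
theorem klFlowFrameU_succ (β U μ : ℝ) (n : ℕ) :
    klFlowFrameU L M β U μ (n + 1) = fsub (klFlowFrameU L M β U μ n) (klFlowPiece L M β U μ n) := rfl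

/-- The flow action at scale `0` is the bare-frame ultraviolet action. -/
theorem klFlowAction_zero (β U μ : ℝ) : klFlowAction L M β U μ 0 = klEffectiveAction L M β U μ 0 klE0 0 := rfl

end Model

/-! ## §1 The named frame-shift term (STAND-IN table, free upward) -/

/-- **STAND-IN `frameShiftBar P Q U n := Q.CR · (P.Klam·U)² · 4^{−n}`** (v3, (R27′)(ii)) — the allowance for the response of the scale-`(n−1)` pair array /
values to the frame shift `K_{n−1} → K_n`.  SHAPE (decaying, `U²`, `Q.CR`-keyed): the typed history gives `‖K_n − K_{n−1}‖_∞ = ‖klFlowPiece (n−1)‖_∞ ≤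
Gfr₀·uPow 0 U·16^{−(n−1)}` ((I-F jets) `j = 0`) and the scale-`(n−1)` array's entrywise frame-modulus is `≲ c·(Klam U)²/Λ_{n−1}`, so the actual shift is
`≲ c·Gfr₀·|U|·(Klam U)²·4^{−n}` — below this bar once `U₀(R) ≤ Q.CR/(c·Gfr₀)` (the `∃Q ∀R ∃U₀` staging absorbs the `R`-level `Gfr₀` into `U₀`, not into `Q`);
SUMMABLE: `Σ_{n ≤ N} frameShiftBar ≤ (4/3)·Q.CR·(Klam U)² ≤ (4/3)·Q.CR·Klam³·U²` (`1 ≤ Klam`), inside child 1's EXISTING tolerance term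
`klLegKappa·Q.CR·Klam³·U²` (numeral slack `720 + 4/3 ≤ 4000`), so `PairArrayAtV17F`'s tolerance text is unchanged. -/
def frameShiftBar (P : SplitConsts) (Q : EngConsts) (U : ℝ) (n : ℕ) : ℝ :=
  Q.CR * (P.Klam * U) ^ 2 * ((4 : ℝ)⁻¹) ^ n

/-- `frameShiftBar ≥ 0` for `Q.CR ≥ 0`. -/
theorem frameShiftBar_nonneg {P : SplitConsts} {Q : EngConsts} (hQ : 0 ≤ Q.CR) (U : ℝ) (n : ℕ) : 0 ≤ frameShiftBar P Q U n := by
  unfold frameShiftBar; positivity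

/-- **The frame-shift allowance is summable along the ladder**: `Σ_{n < N} frameShiftBar P Q U n ≤ (4/3)·Q.CR·(Klam U)²`. -/
theorem sum_frameShiftBar_le {P : SplitConsts} {Q : EngConsts} (hQ : 0 ≤ Q.CR) (U : ℝ) (N : ℕ) :
    ∑ n ∈ range N, frameShiftBar P Q U n ≤ 4 / 3 * (Q.CR * (P.Klam * U) ^ 2) := by
  have hgeo : ∑ n ∈ range N, ((4 : ℝ)⁻¹) ^ n ≤ 4 / 3 := by
    have h := geom_sum_Ico_le_of_lt_one (m := 0) (n := N) (x := (4 : ℝ)⁻¹) (by norm_num) (by norm_num)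
    rw [← Finset.range_eq_Ico] at h
    refine h.trans ?_
    norm_num
  unfold frameShiftBar
  rw [← Finset.mul_sum]
  calc Q.CR * (P.Klam * U) ^ 2 * ∑ n ∈ range N, ((4 : ℝ)⁻¹) ^ n ≤ Q.CR * (P.Klam * U) ^ 2 * (4 / 3) :=
        mul_le_mul_of_nonneg_left hgeo (by positivity)
    _ = 4 / 3 * (Q.CR * (P.Klam * U) ^ 2) := by ring

/-- … and within child 1's `klLegKappa`-slack currency: `≤ (4/3)·Q.CR·Klam³·U²` (`1 ≤ Klam`). -/
theorem sum_frameShiftBar_le_cube {P : SplitConsts} {Q : EngConsts} (hP : 1 ≤ P.Klam) (hQ : 0 ≤ Q.CR) (U : ℝ) (N : ℕ) :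
    ∑ n ∈ range N, frameShiftBar P Q U n ≤ 4 / 3 * (Q.CR * P.Klam ^ 3) * U ^ 2 := by
  refine (sum_frameShiftBar_le hQ U N).trans ?_
  have h1 : P.Klam ^ 2 ≤ P.Klam ^ 3 := pow_le_pow_right₀ hP (by norm_num)
  have h2 : 0 ≤ U ^ 2 := sq_nonneg U
  nlinarith [mul_le_mul_of_nonneg_right h1 h2, hQ, mul_nonneg hQ h2]

/-! ## §2 The engine slot V17F (one-shot objects at `K_n`; cross-scale clauses `(K_n, n)` vs `(K_{n−1}, n−1)`; bare-frame reading ball) -/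

section Model

variable (L M : ℕ) [NeZero L] [NeZero M]

/-- **(B1-F) the pair arrays of the flow action are constant on the BARE-FRAME ball** up to the `Q`-aware tolerance (`PairArrayAtV2` with `K ↦ K_n` in the
object and `klBall L μ K ↦ klBall L μ 0`). -/
def PairArrayAtV17F (P : SplitConsts) (Q : EngConsts) (β U μ : ℝ) (n : ℕ) : Prop :=
  ∀ Qm : TorusSite 2 L,
    ∃ u : ℝ, 0 ≤ u ∧ u ≤ 2 * |U| ∧ ∀ k ∈ klBall L μ 0, ∀ k' ∈ klBall L μ 0,
      ‖klPairAmplitude L M β U μ (klFlowFrameU L M β U μ n) n Qm k k' - (u : ℂ)‖ ≤ (P.C_W + klLegKappa * Q.CR * P.Klam ^ 3) * U ^ 2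

/-- **the `↑↓` value line on the bare-frame ball** (`QuarticValueLineS` with `K ↦ K_n`, ball `↦ klBall L μ 0`). -/
def QuarticValueLineV17F (P : SplitConsts) (β U μ : ℝ) (n : ℕ) : Prop :=
  ∀ k₁ ∈ klBall L μ 0, ∀ k₂ ∈ klBall L μ 0, ∀ k₃ ∈ klBall L μ 0,
    ‖klQuarticValue L M β U μ (klFlowFrameU L M β U μ n) n 0 1 k₁ k₂ k₃‖ ≤ P.Klam * |U|

/-- **`BetaSplitAtV17F`** := (B1-F) ∧ (isotropic endpoint norm line at `K_n` ∧ value line on the bare ball) ∧ `FirstMoments` at `K_n`.  Slot type of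
`Preds.split` once the dummy `K` is prefixed (§5); `G` not read. -/
def BetaSplitAtV17F (_G : GeoConsts) (P : SplitConsts) (Q : EngConsts) (β U μ : ℝ) (n : ℕ) : Prop :=
  PairArrayAtV17F L M P Q β U μ n ∧
    (EndpointNormLineIso L M P β U μ (klFlowFrameU L M β U μ n) n ∧ QuarticValueLineV17F L M P β U μ n) ∧
      FirstMoments L M P β U μ (klFlowFrameU L M β U μ n) n

/-- **(E2-F) one pair-ladder step per scale, CROSS-FRAME** (α′): `PairLadderStepAtV10` with the scale-`n` amplitude at `K_n`, the scale-`(n−1)` array at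
`K_{n−1}`, the bare-frame ball, the FLOWING slice count at `K_n` (γ′), and `+ frameShiftBar P Q U n` in the step majorant. -/
def PairLadderStepAtV17F (G : GeoConsts) (P : SplitConsts) (Q : EngConsts) (β U μ : ℝ) (n : ℕ) : Prop :=
  (n = 0 → ∀ Qm : TorusSite 2 L, ∀ k ∈ klBall L μ 0, ∀ k' ∈ klBall L μ 0,
      ‖klPairAmplitude L M β U μ (klFlowFrameU L M β U μ 0) 0 Qm k k' - (U : ℂ)‖ ≤ initDevBar G U + legDressBarQ2 G P Q U 0 4) ∧
  (1 ≤ n → ∀ Qm : TorusSite 2 L, IsPairClassAt L Qm n →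
      ∃ w : TorusSite 2 L → ℝ, (∑ p, |w p| ≤ G.bhi) ∧ (∑ p, (|w p| - w p) ≤ 2 * klEdge G n (klTorusNorm L Qm)) ∧
        ∃ N : Matrix (TorusSite 2 L) (TorusSite 2 L) ℂ,
          (1 + Matrix.diagonal (fun p => (w p : ℂ)) * klPairArray L M β U μ (klFlowFrameU L M β U μ (n - 1)) (n - 1) Qm) * N = 1 ∧
          ∀ k ∈ klBall L μ 0, ∀ k' ∈ klBall L μ 0,
            ‖klPairAmplitude L M β U μ (klFlowFrameU L M β U μ n) n Qm k k' -
                (klPairArray L M β U μ (klFlowFrameU L M β U μ (n - 1)) (n - 1) Qm * N) k k'‖ ≤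
              drivePBar G P U (n - 1) + eremBar G P Q U β L (n - 1) + thermalBar G P U β n +
                legDressBarQ2 G P Q U n (legSliceCountT L β μ (klFlowFrameU L M β U μ n) n ![k', Qm - k', Qm - k, k]) +
                (P.Klam * U) ^ 2 * (G.phGain n (klTorusNorm L (k - k')) + G.phGain n (klTorusNorm L (k + k' - Qm))) +
                frameShiftBar P Q U n)

/-- **(E2″-F) value increments of the pair arrays, CROSS-FRAME**: `(K_n, n)` against `(K_{n−1}, n−1)`, bare ball, flowing count, `+ frameShiftBar`. -/
def PairValueIncrementAtV17F (G : GeoConsts) (P : SplitConsts) (Q : EngConsts) (β U μ : ℝ) (n : ℕ) : Prop :=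
  1 ≤ n → ∀ Qm : TorusSite 2 L, ∀ k ∈ klBall L μ 0, ∀ k' ∈ klBall L μ 0,
    ‖klPairAmplitude L M β U μ (klFlowFrameU L M β U μ n) n Qm k k' -
        klPairAmplitude L M β U μ (klFlowFrameU L M β U μ (n - 1)) (n - 1) Qm k k'‖ ≤
      gainBar G P U n (klTorusNorm L Qm) (klTorusNorm L (k - k')) (klTorusNorm L (k + k' - Qm)) +
        eremBar G P Q U β L (n - 1) + thermalBar G P U β n +
          legDressBarQ2 G P Q U n (legSliceCountT L β μ (klFlowFrameU L M β U μ n) n ![k', Qm - k', Qm - k, k]) +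
            frameShiftBar P Q U n

/-- **(E2′-F) pointwise increments of the `↑↓` running coupling values, CROSS-FRAME** (as (E2″-F)). -/
def QuarticValueIncrementAtV17F (G : GeoConsts) (P : SplitConsts) (Q : EngConsts) (β U μ : ℝ) (n : ℕ) : Prop :=
  1 ≤ n → ∀ k₁ ∈ klBall L μ 0, ∀ k₂ ∈ klBall L μ 0, ∀ k₃ ∈ klBall L μ 0,
    ‖klQuarticValue L M β U μ (klFlowFrameU L M β U μ n) n 0 1 k₁ k₂ k₃ -
        klQuarticValue L M β U μ (klFlowFrameU L M β U μ (n - 1)) (n - 1) 0 1 k₁ k₂ k₃‖ ≤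
      gainBar G P U n (klTorusNorm L (k₁ + k₃)) (klTorusNorm L (k₁ - k₂)) (klTorusNorm L (k₂ - k₃)) +
        eremBar G P Q U β L (n - 1) + thermalBar G P U β n +
          legDressBarQ2 G P Q U n (legSliceCountT L β μ (klFlowFrameU L M β U μ n) n ![k₁, k₂, k₃, k₁ - k₂ + k₃]) +
            frameShiftBar P Q U n

/-- **(E2′-F UV) the ultraviolet size of the `↑↓` values** at `K₀ = 0` on the bare ball. -/
def QuarticValueUVAtV17F (G : GeoConsts) (P : SplitConsts) (Q : EngConsts) (β U μ : ℝ) (n : ℕ) : Prop :=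
  n = 0 → ∀ k₁ ∈ klBall L μ 0, ∀ k₂ ∈ klBall L μ 0, ∀ k₃ ∈ klBall L μ 0,
    ‖klQuarticValue L M β U μ (klFlowFrameU L M β U μ 0) 0 0 1 k₁ k₂ k₃‖ ≤ |U| + initDevBar G U + legDressBarQ2 G P Q U 0 4

/-- **(E5-F) iso-tuple `L¹` from a value bound on the bare ball**, one-shot at `K_n` (`IsoTupleL1AtS` with `K ↦ K_n`, ball `↦ klBall L μ 0`). -/
def IsoTupleL1AtV17F (G : GeoConsts) (P : SplitConsts) (β U μ : ℝ) (n : ℕ) : Prop :=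
  ∀ B : ℝ, 0 ≤ B →
    (∀ k₁ ∈ klBall L μ 0, ∀ k₂ ∈ klBall L μ 0, ∀ k₃ ∈ klBall L μ 0,
        ‖klQuarticValue L M β U μ (klFlowFrameU L M β U μ n) n 0 1 k₁ k₂ k₃‖ ≤ B) →
      ∀ m : ℕ, n ≤ m → ∀ Ω ∈ bgmSectorSet L M (klIsoFamily L M β μ (klFlowFrameU L M β U μ n) klE0 m) 4, ∀ x₁ : SpaceTimeIdx L M,
        fixedTupleL1 L M β 3 (klIsoKernelAt L M β U μ (klFlowFrameU L M β U μ n) n m) Ω x₁ ≤ G.CF * B + G.CF * (P.Klam * U) ^ 2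

/-- **`EngineBoundsAtV17F … G P Q n`** — the V10S engine output in scheme F, conjunct ORDER KEPT:
(E0) `SelfEnergySymmetric` at `K_n` ∧ (E1-v4) `KernelNormsV4` at `K_n` ∧ (E2-F) ∧ (E2″-F) ∧ (E2′-F) ∧ (E2′-F UV) ∧ (E4) `EngineFirstMoments` at `K_n` ∧ (E5-F). -/
def EngineBoundsAtV17F (G : GeoConsts) (P : SplitConsts) (Q : EngConsts) (β U μ : ℝ) (n : ℕ) : Prop :=
  SelfEnergySymmetric L M β U μ (klFlowFrameU L M β U μ n) n ∧ KernelNormsV4 L M P Q β U μ (klFlowFrameU L M β U μ n) n ∧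
    PairLadderStepAtV17F L M G P Q β U μ n ∧ PairValueIncrementAtV17F L M G P Q β U μ n ∧
      QuarticValueIncrementAtV17F L M G P Q β U μ n ∧ QuarticValueUVAtV17F L M G P Q β U μ n ∧
        EngineFirstMoments L M G P Q β U μ (klFlowFrameU L M β U μ n) n ∧ IsoTupleL1AtV17F L M G P β U μ n

/-! ## §3 The two-leg slot V17F (cumulative-reading jets, slopes, two-volume rate at the flow frames of each volume) -/

/-- **(E3a-F) the CUMULATIVE-READING jets**: the scale-`n` local part of the flow action read on `K_n`'s own curve, `θ ↦ ν_n(K_n)(θ)`, is `C⁴` in the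
angle with `|∂_θ^k ν_n(K_n)| ≤ curveJetBar G.S Q.S' U k n` for `k ≤ 4` (the `TwoLegCurveJetBound` currency; cumulative because the frame has cancelled
the readings below `n`, so the cumulative reading IS of increment size). -/
def TwoLegReadJetsF (G : GeoConsts) (Q : EngConsts) (β U μ : ℝ) (n : ℕ) : Prop :=
  ContDiff ℝ 4 (fun θ : ℝ => klLocalPart L M β U μ (klFlowFrameU L M β U μ n) n θ) ∧
    ∀ k ≤ 4, ∀ θ : ℝ,
      |iteratedDeriv k (fun θ : ℝ => klLocalPart L M β U μ (klFlowFrameU L M β U μ n) n θ) θ| ≤ curveJetBar G.S Q.S' U k n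

/-- **(E3f-F) the two-volume rate at the flow frames OF EACH VOLUME** (T1d-T thresholds; PF-1 fork (α)): above the reader's threshold `Mq` and `Q.M0`, with the
history at every volume from `L` up, the scale-`n` readings of the volumes `(L, M)` and `(L′, M′)` — each in ITS OWN flow frame — differ by `≤ Q.CL β n / L`. -/
def TwoLegVolumeRateF (hist : (L' M' : ℕ) → [NeZero L'] → [NeZero M'] → ℕ → Prop) (Q : EngConsts) (β U μ : ℝ) (n : ℕ) : Prop :=
  ∀ Mq : ℕ → ℕ, Q.M0 β L ≤ M → Mq L ≤ M →
    (∀ (L'' M'' : ℕ) [NeZero L''] [NeZero M''], L ≤ L'' → Q.M0 β L'' ≤ M'' → Mq L'' ≤ M'' → ∀ j < n, hist L'' M'' j) →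
      ∀ (L' M' : ℕ) [NeZero L'] [NeZero M'], L ≤ L' → Q.M0 β L' ≤ M' → Mq L' ≤ M' →
        ∀ θ : ℝ, |klLocalPart L M β U μ (klFlowFrameU L M β U μ n) n θ - klLocalPart L' M' β U μ (klFlowFrameU L' M' β U μ n) n θ| ≤
          Q.CL β n / L

end Model

/-! ## §4 The renormalisation slot V17F (what the forward induction proves at stage `n`) -/

/-- **(I-F jets) the ACTUAL scale-`n` flow piece has the jets of an admissible frame piece**: `‖Dʲ evalM (klFlowPiece n)‖ ≤ R.Gfr j · uPow j U · 4^{(j−2)n}`,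
`j ≤ 4` (the `FrameOK` piece clause, now about the CONSTRUCTED piece: Jackson ∘ tube extension of (E3a-F)'s jets). -/
def FlowPieceJetsAt (L M : ℕ) [NeZero L] [NeZero M] (β U μ : ℝ) (R : RenConsts) (n : ℕ) : Prop :=
  ∀ j ≤ 4, ∀ q : Momentum,
    ‖iteratedFDeriv ℝ j (evalM (klFlowPiece L M β U μ n)) q‖ ≤ R.Gfr j * uPow j U * (4 : ℝ) ^ (((j : ℤ) - 2) * n)

/-- **(I-F geometry) Lemma-2.1 geometry of the NEXT renormalised band** `ε − μ − K_{n+1}`: the `GeomConstants` clause of `FrameOK` at the flow frame. -/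
def FlowGeometryAt (L M : ℕ) [NeZero L] [NeZero M] (β U μ : ℝ) (n : ℕ) : Prop :=
  GeomConstants (frameLevel μ (klFlowFrameU L M β U μ (n + 1))) 7 (3 / 80) (1 / 2) (3 / 200)

/-- **`RenormFlowAtV17F … R n`** := `RenormalisedAtF … K_n R n` (the scale-`n` reading of the flow action is within the quadratic tolerance) ∧ (I-F jets) ∧
(I-F geometry).  Slot type of `Preds.renorm` once the dummy `K` is inserted (§5). -/
def RenormFlowAtV17F (L M : ℕ) [NeZero L] [NeZero M] (β U μ : ℝ) (R : RenConsts) (n : ℕ) : Prop :=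
  RenormalisedAtF L M β U μ (klFlowFrameU L M β U μ n) R n ∧ FlowPieceJetsAt L M β U μ R n ∧ FlowGeometryAt L M β U μ n

section Model

variable (L M : ℕ) [NeZero L] [NeZero M]

/-- **The comparison-volume history of the V17F bundle at scale `j`** (for (E3f-F)'s antecedent): split ∧ renorm ∧ engine ∧ reading jets of THAT volume's flow. -/
def histV17F (G : GeoConsts) (P : SplitConsts) (Q : EngConsts) (R : RenConsts) (β U μ : ℝ) : ℕ → Prop :=
  fun j => BetaSplitAtV17F L M G P Q β U μ j ∧ RenormFlowAtV17F L M β U μ R j ∧ EngineBoundsAtV17F L M G P Q β U μ j ∧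
    TwoLegReadJetsF L M G Q β U μ j

/-- **`TwoLegStepV17F … G P Q R n`** := (E3a-F) reading jets ∧ (E3d/e) `TwoLegSlopes` at `K_n` ∧ (E3f-F) two-volume rate with history `histV17F` (∧ slopes) at
every volume.  Slot type of `Preds.twoLeg` once the dummy `K` is inserted. -/
def TwoLegStepV17F (G : GeoConsts) (P : SplitConsts) (Q : EngConsts) (R : RenConsts) (β U μ : ℝ) (n : ℕ) : Prop :=
  TwoLegReadJetsF L M G Q β U μ n ∧ TwoLegSlopes L M R β U μ (klFlowFrameU L M β U μ n) n ∧
    TwoLegVolumeRateF L M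
      (fun L'' M'' _ _ j => histV17F L'' M'' G P Q R β U μ j ∧ TwoLegSlopes L'' M'' R β U μ (klFlowFrameU L'' M'' β U μ j) j)
      Q β U μ n

end Model

/-! ## §5 The bundle `klPredsV17F` (dummy frame argument, PF-0) and the bookkeeping -/

/-- **`klPredsV17F : Preds`** — scheme F in the existing slot machinery: the frame argument is a DUMMY (`frameOK … K := K = 0 ∧ FrameOK R U N μ K`; no other
slot reads `K`),
every slot reads the DEFINED flow frame `K_n = klFlowFrameU L M β U μ n`.  Children (PRICING §6 step 2, on the pen's verb only):
`EngineP4 | BetaSplitP | CountertermP2 (forward induction) | VolumeLimitP2 | TwoPointAssemblyP3` on `klPredsV17F klWindowC`. -/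
def klPredsV17F : Preds where
  frameOK := fun R U N μ K => K = 0 ∧ FrameOK R U N μ K
  renorm := fun L M _ _ β U μ _ R n => RenormFlowAtV17F L M β U μ R n
  split := fun L M _ _ G P Q β U μ _ n => BetaSplitAtV17F L M G P Q β U μ n
  engine := fun L M _ _ G P Q β U μ _ n => EngineBoundsAtV17F L M G P Q β U μ n
  twoLeg := fun L M _ _ G P Q R β U μ _ n => TwoLegStepV17F L M G P Q R β U μ n

/-- The frame class of V17F is `{0} ∩ FrameOK` ((R27′)(i), (T-a): the `FrameOK` conjunct lets every bare-frame door keyed on `FrameOK … K` instantiate verbatim). -/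
theorem klPredsV17F_frameOK_iff (R : RenConsts) (U : ℝ) (N : ℕ) (μ : ℝ) (K : TrigPolyC4v) :
    klPredsV17F.frameOK R U N μ K ↔ K = 0 ∧ FrameOK R U N μ K := Iff.rfl

section Model

variable (L M : ℕ) [NeZero L] [NeZero M] (G : GeoConsts) (P : SplitConsts) (Q : EngConsts) (R : RenConsts) (β U μ : ℝ) (K : TrigPolyC4v) (n : ℕ)

/-- V17F's engine slot ignores `K` and reads `K_n`. -/
theorem klPredsV17F_engine_apply : klPredsV17F.engine L M G P Q β U μ K n = EngineBoundsAtV17F L M G P Q β U μ n := rfl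

/-- V17F's split slot ignores `K` and reads `K_n`. -/
theorem klPredsV17F_split_apply : klPredsV17F.split L M G P Q β U μ K n = BetaSplitAtV17F L M G P Q β U μ n := rfl

/-- V17F's renormalisation slot ignores `K` and reads `K_n`. -/
theorem klPredsV17F_renorm_apply : klPredsV17F.renorm L M β U μ K R n = RenormFlowAtV17F L M β U μ R n := rfl

/-- V17F's two-leg slot ignores `K` and reads `K_n`. -/
theorem klPredsV17F_twoLeg_apply : klPredsV17F.twoLeg L M G P Q R β U μ K n = TwoLegStepV17F L M G P Q R β U μ n := rfl

/-- **The V17F history is the slot facts at `(K_j, j)`, `j < n`, for EVERY dummy `K`** (`Iff.rfl`): `HistP`'s hard-wired «same `K` across scales» is harmless. -/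
theorem histP_klPredsV17F_iff :
    HistP klPredsV17F L M G P Q R β U μ K n ↔
      ∀ j < n, BetaSplitAtV17F L M G P Q β U μ j ∧ RenormFlowAtV17F L M β U μ R j ∧
        EngineBoundsAtV17F L M G P Q β U μ j ∧ TwoLegStepV17F L M G P Q R β U μ j := Iff.rfl

/-- The V17F history does not depend on the dummy frame. -/
theorem histP_klPredsV17F_frame_irrel (K' : TrigPolyC4v) :
    HistP klPredsV17F L M G P Q R β U μ K n ↔ HistP klPredsV17F L M G P Q R β U μ K' n := Iff.rfl

/-- The V17F history discharges the comparison history `histV17F` of the SAME volume at every `j < n`. -/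
theorem histV17F_of_histP {L M : ℕ} [NeZero L] [NeZero M] {G : GeoConsts} {P : SplitConsts} {Q : EngConsts} {R : RenConsts} {β U μ : ℝ}
    {K : TrigPolyC4v} {n : ℕ} (h : HistP klPredsV17F L M G P Q R β U μ K n) : ∀ j < n, histV17F L M G P Q R β U μ j :=
  fun j hj => ⟨(h j hj).1, (h j hj).2.1, (h j hj).2.2.1, (h j hj).2.2.2.1⟩

end Model

/-! ## §6 Bookkeeping PROVED: the flow frame is minus the sum of its pieces; `FrameOK` of `K_{N+1}` from the stage facts; the frame RATE from (I-F jets) -/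

section Model

variable (L M : ℕ) [NeZero L] [NeZero M]

/-- **`K_n = −Σ_{m<n} klFlowPiece m`** pointwise. -/
theorem eval_klFlowFrameU (β U μ : ℝ) (n : ℕ) (p : Fin 2 → ℝ) :
    (klFlowFrameU L M β U μ n).eval p = -∑ m ∈ range n, (klFlowPiece L M β U μ m).eval p := by
  induction n with
  | zero => simp [klFlowFrameU_zero]
  | succ n ih => rw [klFlowFrameU_succ, eval_fsub, ih, sum_range_succ]; ring

variable {L M}

/-- **`FrameOK R U N μ K_{N+1}` from the stage facts** (I-F jets) at every `m ≤ N` and (I-F geometry) at `N`: the CT engine's frame input, now at the flow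
frame, with the pieces `0 ⊖ klFlowPiece m` (as `frameOK_counterterm`). -/
theorem frameOK_klFlowFrameU_succ {β U μ : ℝ} {R : RenConsts} {N : ℕ} (hJ : ∀ m ≤ N, FlowPieceJetsAt L M β U μ R m)
    (hG : FlowGeometryAt L M β U μ N) : FrameOK R U N μ (klFlowFrameU L M β U μ (N + 1)) := by
  refine ⟨hG, fun m => fsub 0 (klFlowPiece L M β U μ m), fun p => ?_, fun m hm j hj q => ?_⟩
  · rw [eval_klFlowFrameU]
    simp only [eval_fsub, TrigPolyC4v.eval_zero, zero_sub, sum_neg_distrib]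
  · rw [evalM_fsub_zero, iteratedFDeriv_neg_apply, norm_neg]
    exact hJ m hm j hj q

/-- **The frame RATE along the flow from (I-F jets)** (the input of a flowing slice-count lemma, (γ′) option 1): for `j ≤ n`,
`|K_n(q) − K_j(q)| ≤ Σ_{j ≤ m < n} Gfr 0 · uPow 0 U · 4^{−2m}`. -/
theorem abs_evalM_klFlowFrameU_sub_le {β U μ : ℝ} {R : RenConsts} {j n : ℕ} (hjn : j ≤ n) (hJ : ∀ m < n, FlowPieceJetsAt L M β U μ R m)
    (q : Momentum) :
    |evalM (klFlowFrameU L M β U μ n) q - evalM (klFlowFrameU L M β U μ j) q| ≤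
      ∑ m ∈ Ico j n, R.Gfr 0 * uPow 0 U * (4 : ℝ) ^ ((((0 : ℕ) : ℤ) - 2) * (m : ℤ)) := by
  rw [evalM_apply, evalM_apply, eval_klFlowFrameU, eval_klFlowFrameU, ← Finset.sum_range_add_sum_Ico _ hjn]
  rw [show -(∑ m ∈ range j, (klFlowPiece L M β U μ m).eval (WithLp.ofLp q) + ∑ m ∈ Ico j n, (klFlowPiece L M β U μ m).eval (WithLp.ofLp q)) -
      -∑ m ∈ range j, (klFlowPiece L M β U μ m).eval (WithLp.ofLp q) = -∑ m ∈ Ico j n, (klFlowPiece L M β U μ m).eval (WithLp.ofLp q) by ring,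
    abs_neg]
  refine (Finset.abs_sum_le_sum_abs _ _).trans (Finset.sum_le_sum fun m hm => ?_)
  have hm : m < n := (Finset.mem_Ico.1 hm).2
  have h := hJ m hm 0 (Nat.zero_le _) q
  rwa [norm_iteratedFDeriv_zero, Real.norm_eq_abs, evalM_apply] at h

end Model

end Summit.HubbardSuperconductivity.HubbardSuperconductivity.Theorems.KLRegimeSplit

end
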